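import Literature.AlgebraicGeometry.Motives.AbelianVarietyGlobalOneFormsMulNHolds
import Literature.AlgebraicGeometry.Motives.AbelianVarietyTorsion
import Literature.AlgebraicGeometry.AbelianSchemes.AbelianSchemeQuotientMulNDescent
import Literature.AlgebraicGeometry.AbelianSchemes.AbelianSchemeOverField
import HarnessLib

/-!
# `[n]^* ω = n · ω` on global `1`-forms, in the `AbelianSchemeOver (Spec k)` ∕ `mulN` carrier
# ([MumfordAV1970] §4 (iv), p. 42–43; the carrier bridge to ★ `Motives/AbelianVarietyGlobalOneFormsMulNHolds`)

Layer `Literature/AlgebraicGeometry/AbelianSchemes`, namespace `Literature.AlgebraicGeometry.AbelianSchemes.AbelianSchemeOver`.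
THEOREMS ONLY (no definition, no named fact, no instance).  ★ `Motives.AbelianVariety.comap_zsmul_one_app_top ∕ _map` (B-p16 (g19),
p797688) prove `[n]^♯ ω = n • ω` for every global `1`-form `ω ∈ Γ(A, Ω¹_{A/K})` of an abelian variety `A : Motives.AbelianVariety K`
with `[n] := (n • 𝟙 A).hom.hom.hom`.  The deformation-theoretic consumers (F-11 α1 / J4-(iv), slot rel₁ of the GAP-2 assembly) hold
the CLOSED FIBRE of an abelian scheme as `B : AbelianSchemeOver (Spec (.of k))` (`B := A₀.baseChange s`) and multiplication by `n`
as `B.mulN n = (𝟙 B.X) ^ n` (★ `AbelianSchemes/AbelianSchemeQuotientMulNDescent`).  This file is the dictionary: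

* `mulN_eq_hom_zsmul_one` — `B.mulN n = ((n : ℤ) • 𝟙 B.toAffine.toAbelianVariety).hom.hom.hom` as morphisms `B.X ⟶ B.X` over
  `Spec k` (same group object: ★ `toAffine_X`, `toAbelianVariety_X` are `rfl`; ★ `AbelianVariety.hom_zsmul_id`, `zpow_natCast` — the
  `Over`-level form of ★ `mulN_baseChange_left_eq_toSchemeHom`);
* **`comap_mulN_app_top (n : ℕ) (ω : Γ(cotangentSheaf B.X, ⊤)) : [n]^♯ ω = (n : ℤ) • ω`** and the cochain form
  **`comap_mulN_app_map … (V) : [n]^♯ (ω|_V) = (n : ℤ) • ω|_{[n]⁻¹V}`** for `[n] := B.mulN n`;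
* `comap_mulN_app_top_natCast ∕ _map_natCast` — the same with the scalar written as the section `(n : Γ(B.X, 𝒪))`, and
  `comap_mulN_app_top_algebraMap ∕ _map_algebraMap` — with the scalar `algebraMap k Γ(B.X, 𝒪) n` for any family of `k`-algebra structures
  on the sections (the shape of the `hω` binder of the Čech functoriality letter `Deformation/SmoothSchemeLiftObstructionFunctorialCech`).

Cell `hodgecm-mathlib` (D-0151), F-11 (iv) road (a′), (R95)(2)(a) (F0P1b-plan (g0)); consumers F0P1b-p05∕p06 `GAP2_of_slots` slot rel₁ at
`X := (A₀.baseChange s).X`, `f := (A₀.baseChange s).mulN 2`, and B-p08 (g16)'s FILE B2.  Generic and count-neutral; HC_CM is proved only modulo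
the 7 printed citations until rung 0 closes — nothing here refers to it.  Mathlib searched (pin v4.32): `zpow_natCast`, `Int.cast_smul_eq_zsmul`,
`Nat.cast_smul_eq_nsmul`, `map_natCast` (used).

## References

* D. Mumford, *Abelian Varieties* (1970), §4 (iv), pp. 42–43 (`(f + g)^* ω = f^* ω + g^* ω` on invariant forms). [MumfordAV1970]
* U. Görtz, T. Wedhorn, *Algebraic Geometry II* (2023), (27.35.1) and Rem. 27.18 (1) (pp. 610–611). [GortzWedhorn2023]
* D. Mumford, J. Fogarty, F. Kirwan, *Geometric Invariant Theory*, 3rd ed. (1994), Ch. 6 §1 (p. 115) (`[n]` on an abelian scheme). [MumfordFogartyKirwan1994]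
-/

noncomputable section

open CategoryTheory AlgebraicGeometry Opposite TopologicalSpace

namespace Literature.AlgebraicGeometry.AbelianSchemes.AbelianSchemeOver

open Literature.AlgebraicGeometry.Motives Literature.AlgebraicGeometry.HodgeTheory
open scoped MonObj

variable {k : Type} [Field k] (B : AbelianSchemeOver (Spec (.of k)))

/-! ## §1 The carrier bridge `mulN n = (n • 𝟙)` -/

/-- **`[n]` of an abelian scheme over `Spec k` is `n • 𝟙` of the associated abelian variety**, as morphisms `B.X ⟶ B.X` over `Spec k`
(★ `mulN_def`: `B.mulN n = (𝟙 B.X) ^ n`; ★ `AbelianVariety.hom_zsmul_id`: `(n • 𝟙 A).hom.hom.hom = (𝟙 A.X) ^ n`; the underlying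
`k`-group scheme of `B.toAffine.toAbelianVariety` is `B.X` definitionally). [cite: GortzWedhorn2023, (27.35.1)]
[cite: MumfordFogartyKirwan1994, Ch. 6 §1 (p. 115)] -/
theorem mulN_eq_hom_zsmul_one (n : ℕ) :
    B.mulN n = ((n : ℤ) • 𝟙 B.toAffine.toAbelianVariety).hom.hom.hom := by
  rw [AbelianVariety.hom_zsmul_id, zpow_natCast]
  rfl

/-- The same on the underlying morphisms of schemes: `(B.mulN n).left = Hom.toSchemeHom (n • 𝟙 _)`.
[cite: GortzWedhorn2023, (27.35.1)] [cite: MumfordFogartyKirwan1994, Ch. 6 §1 (p. 115)] -/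
theorem mulN_left_eq_toSchemeHom (n : ℕ) :
    (B.mulN n).left = AbelianVariety.Hom.toSchemeHom ((n : ℤ) • 𝟙 B.toAffine.toAbelianVariety) := by
  rw [mulN_eq_hom_zsmul_one]

/-! ## §2 `[n]^♯ ω = n • ω` for `[n] = B.mulN n` -/

/-- **`[n]^♯ ω = n • ω` for every global `1`-form `ω` of an abelian scheme `B` over a field, `[n] := B.mulN n`**
(★ `AbelianVariety.comap_zsmul_one_app_top` through the bridge). [cite: MumfordAV1970, §4 (iv) (p. 42–43)]
[cite: GortzWedhorn2023, Rem. 27.18 (1) (pp. 610–611)] -/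
theorem comap_mulN_app_top (n : ℕ) (ω : Γ(cotangentSheaf B.X, ⊤)) :
    (show Γ(cotangentSheaf B.X, ⊤) from (cotangentSheaf.comap (B.mulN n)).app ⊤ ω) = (n : ℤ) • ω := by
  rw [mulN_eq_hom_zsmul_one]
  exact AbelianVariety.comap_zsmul_one_app_top (A := B.toAffine.toAbelianVariety) n ω

/-- **Cochain form**: `[n]^♯ (ω|_V) = n • ω|_{[n]⁻¹V}` in `Γ(Ω¹, [n]⁻¹V)` for every open `V`, `[n] := B.mulN n`
(★ `AbelianVariety.comap_zsmul_one_app_map` through the bridge). [cite: MumfordAV1970, §4 (iv) (p. 42–43)]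
[cite: GortzWedhorn2023, Rem. 27.18 (1) (pp. 610–611)] -/
theorem comap_mulN_app_map (n : ℕ) (ω : Γ(cotangentSheaf B.X, ⊤)) (V : B.X.left.Opens) :
    (cotangentSheaf.comap (B.mulN n)).app V ((cotangentSheaf B.X).presheaf.map (homOfLE (le_top : V ≤ ⊤)).op ω) =
      (n : ℤ) • (cotangentSheaf B.X).presheaf.map (homOfLE (le_top : (B.mulN n).left ⁻¹ᵁ V ≤ ⊤)).op ω := by
  rw [mulN_eq_hom_zsmul_one]
  exact AbelianVariety.comap_zsmul_one_app_map (A := B.toAffine.toAbelianVariety) n ω V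

/-! ## §3 The scalar as a section: `(n : Γ(B.X, 𝒪))` and `algebraMap k Γ(B.X, 𝒪) n` -/

/-- `[n]^♯ ω = (n : Γ(B.X, 𝒪)) • ω` (the scalar as the constant global function).
[cite: MumfordAV1970, §4 (iv) (p. 42–43)] -/
theorem comap_mulN_app_top_natCast (n : ℕ) (ω : Γ(cotangentSheaf B.X, ⊤)) :
    (show Γ(cotangentSheaf B.X, ⊤) from (cotangentSheaf.comap (B.mulN n)).app ⊤ ω) = (n : Γ(B.X.left, ⊤)) • ω := by
  rw [comap_mulN_app_top, Nat.cast_smul_eq_nsmul Γ(B.X.left, ⊤) n ω, ← natCast_zsmul ω n]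

/-- Cochain form with the scalar as a section: `[n]^♯ (ω|_V) = (n : Γ([n]⁻¹V, 𝒪)) • ω|_{[n]⁻¹V}`.
[cite: MumfordAV1970, §4 (iv) (p. 42–43)] -/
theorem comap_mulN_app_map_natCast (n : ℕ) (ω : Γ(cotangentSheaf B.X, ⊤)) (V : B.X.left.Opens) :
    (cotangentSheaf.comap (B.mulN n)).app V ((cotangentSheaf B.X).presheaf.map (homOfLE (le_top : V ≤ ⊤)).op ω) =
      (n : Γ(B.X.left, (B.mulN n).left ⁻¹ᵁ V)) •
        (cotangentSheaf B.X).presheaf.map (homOfLE (le_top : (B.mulN n).left ⁻¹ᵁ V ≤ ⊤)).op ω := by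
  rw [comap_mulN_app_map, Nat.cast_smul_eq_nsmul Γ(B.X.left, (B.mulN n).left ⁻¹ᵁ V) n, ← natCast_zsmul _ n]

/-- `[n]^♯ ω = algebraMap k Γ(B.X, 𝒪) n • ω` for ANY family of `k`-algebra structures on the rings of sections (the `hω` shape of the
Čech functoriality letter: `(comap f).app ⊤ ω = algebraMap k Γ(Y, ⊤) M • ω'` with `f := B.mulN n`, `ω' := ω`, `M := n`).
[cite: MumfordAV1970, §4 (iv) (p. 42–43)] -/
theorem comap_mulN_app_top_algebraMap [∀ W : B.X.left.Opens, Algebra k Γ(B.X.left, W)] (n : ℕ) (ω : Γ(cotangentSheaf B.X, ⊤)) :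
    (cotangentSheaf.comap (B.mulN n)).app ⊤ ω =
      (show Γ(cotangentSheaf B.X, ⊤) from algebraMap k Γ(B.X.left, ⊤) (n : k) • ω) := by
  rw [map_natCast]
  exact comap_mulN_app_top_natCast B n ω

/-- Cochain form with `algebraMap`: `[n]^♯ (ω|_V) = algebraMap k Γ([n]⁻¹V, 𝒪) n • ω|_{[n]⁻¹V}`.
[cite: MumfordAV1970, §4 (iv) (p. 42–43)] -/
theorem comap_mulN_app_map_algebraMap [∀ W : B.X.left.Opens, Algebra k Γ(B.X.left, W)] (n : ℕ) (ω : Γ(cotangentSheaf B.X, ⊤))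
    (V : B.X.left.Opens) :
    (cotangentSheaf.comap (B.mulN n)).app V ((cotangentSheaf B.X).presheaf.map (homOfLE (le_top : V ≤ ⊤)).op ω) =
      algebraMap k Γ(B.X.left, (B.mulN n).left ⁻¹ᵁ V) (n : k) •
        (cotangentSheaf B.X).presheaf.map (homOfLE (le_top : (B.mulN n).left ⁻¹ᵁ V ≤ ⊤)).op ω := by
  rw [map_natCast]
  exact comap_mulN_app_map_natCast B n ω V

end Literature.AlgebraicGeometry.AbelianSchemes.AbelianSchemeOver

end
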